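import Literature.AnabelianGeometry.AbsoluteAnabelian.AbsTopII.EllipticCuspidalizationComparisonClosures
import Literature.AnabelianGeometry.AbsoluteAnabelian.AbsTopII.CuspidalizationInputsGenSubpadic
import Literature.AnabelianGeometry.AbsoluteAnabelian.SubpadicExamples
import Literature.AnabelianGeometry.AbsoluteAnabelian.SubpadicIsGeneralizedSubpadic
import Literature.AnabelianGeometry.AbsoluteAnabelian.GeneralizedSubpadicSlimProofs
import Literature.AnabelianGeometry.AbsoluteAnabelian.SlimTransport
import Literature.AnabelianGeometry.SemiGraphs.WitnessIwahoriGroup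
import HarnessLib

/-!
# [AbsTopII] Cor 3.3 (i), (ii), (iii) over `(𝒟, M)`: the universal closures of the schemata
# `EllipticModel.Cor_3_3_i/ii/iii` are FALSE (kernel counter-model over the real field `ℚ₂`)
# — FACT-LIST rows F-0289, F-0290, F-0291

S. Mochizuki, *Topics in Absolute Anabelian Geometry II: Decomposition Groups and Endomorphisms*
[AbsTopII], Corollary 3.3 (i) pp. 67–68, (ii) p. 68, (iii) pp. 68–69 (manuscript pagination, lit key
`paper:url-585b8d0ad0d9`; bib key `MochizukiAbsTopII2013`).  PROOF-ONLY companion (no `def`, no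
instance, no structure) of `AbsTopII/EllipticCuspidalizationComparison.lean` (abc-iut-L4, p409138) and
of `AbsTopII/EllipticCuspidalizationComparisonClosures.lean` (abc-iut-f-067, p429178: the universal
closure over models holds iff it is vacuous).  abc-iut cell, block F, seat abc-iut-f-067, FACT-LIST rows
**F-0289** `EllipticModel.Cor_3_3_i`, **F-0290** `EllipticModel.Cor_3_3_ii`, **F-0291**
`EllipticModel.Cor_3_3_iii` (`kernel_closedness = parametrised`; plan rule R1/R5).

* `EllipticModel.forall_cor_3_3_i_imp_coHopfian` — the (i)-analogue of "closure ⇒ vacuity": if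
  `M.Cor_3_3_i` held for EVERY model `M` over `𝒟`, then for every Cor-3.3 member `X` whose trivial
  `Π`-chain satisfies (3_Π) for `Σ`, every injective continuous endomorphism `ψ : Π → Π` over `G` with
  open image would be SURJECTIVE: the model in which `X` is its own `k`-core (`coreExt := Π ↠ G`,
  `toCore := 𝟙`, free model data) is a model; a realizing chain `c` with `c.last ≅ Π` that is
  `ÉtLoc`-terminal must, by the UNIQUENESS clause of `IsEtLocTerminalFor` applied to the trivial chain,
  conjugate `e⁻¹ ∘ ψ` into `e⁻¹`, whence `ψ = Inn(e t)` is onto.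
* `EllipticModel.exists_isCor33Member_witness` — a KERNEL INHABITANT of the standing hypotheses of
  Cor 3.3 over a class satisfying the `𝒟`-hypotheses (built inside the proof): the one-object class of
  construction data over the REAL field `ℚ₂` whose morphisms ARE the outer isomorphisms over `G_{ℚ₂}`
  (rel-isom-DGC by construction; no chain terms, so chain-full), with member
  `Π := Iw₂ × G_{ℚ₂} ↠ G_{ℚ₂}` (`Iw₂ = ℤ₂ ⋊ (1 + 2ℤ₂)`, the slim pro-`2` group `SemiGraphs.Iw 2`;
  `G_{ℚ₂}` slim by [Tpcs] Lem 4.14 as proved in the tree; `χ₂` open by [AbsTopIII] Rmk 1.5.4 (i) as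
  proved in the tree; `Σ` = all primes), a junk `EllipticModel` with one setting, and the endomorphism
  `ψ((a, s), g) := ((2a, s), g)` of `Π` over `G_{ℚ₂}` — injective, image open (index `2`), NOT onto.
* `EllipticModel.not_forall_cor_3_3_i` / `not_forall_cor_3_3_ii` / `not_forall_cor_3_3_iii` —
  **universal closures over `(𝒟, M)` REFUTED** (universe `0`); (ii)/(iii) through the iff-vacuous
  lemmas of the Closures companion.

HONEST FRAMING: the three rows are SCHEMATA over the cell's typed interface (model data
`coreExt / doubleCovers / PiD / Setting` are free), to be consumed BY NAME at the intended étale-`π₁`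
model; a toy counter-model over `ℚ₂` says nothing about hyperbolic orbicurves, nothing about the
published theorem [AbsTopII] Cor 3.3, nothing about [IUTchIII] Cor 3.12; refuted-closure ≠
refuted-paper; no side taken; typed ≠ proved for the geometric instance.
-/

noncomputable section

open CategoryTheory Topology

namespace Literature.AnabelianGeometry.AbsoluteAnabelian.AbsTopII

open Literature.AlgebraicGeometry.Frobenioids (IsSlimGroup)
open FundamentalExtension
open AbsTopI (ConstructionDataClass)
open AbsTopIII (IsGeneralizedSubpadicFor IsSubpadicFor cyclotomicChar)
open Literature.AnabelianGeometry.SemiGraphs (Iw)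

universe u

namespace EllipticModel

variable {𝒟 : ConstructionDataClass.{u}}

/-- **F-0289 — the universal closure over models of `EllipticModel.Cor_3_3_i` forces every member's
`Π` to be co-Hopfian over `G`.**  If `M.Cor_3_3_i` holds for every model `M` over `𝒟`, then for every
member `X` of a model satisfying the standing hypotheses of Cor 3.3, whose trivial `Π`-chain satisfies
(3_Π) for `Σ`, every injective continuous endomorphism `ψ` of `Π` over `G` with open image is
surjective (model with `X` its own `k`-core; uniqueness clause of `ÉtLoc`-terminality against the
trivial chain). [cite: MochizukiAbsTopII2013, Cor 3.3 (i) pp.67-68] -/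
theorem forall_cor_3_3_i_imp_coHopfian (H : ∀ M : EllipticModel 𝒟, M.Cor_3_3_i)
    (hfull : 𝒟.IsChainFull) (hGC : 𝒟.RelIsomDGC) (M : EllipticModel 𝒟) (b : 𝒟.Base)
    (X : (𝒟.datum b).Obj) (h : M.IsCor33Member b X)
    (hS : IsProSigmaChain (𝒟.datum b).primes
      (trivialChain (M.cusps b X) h.arith_slim h.geom_slim h.geom_ne_bot))
    (ψ : ((𝒟.datum b).ext X).arith →ₜ* ((𝒟.datum b).ext X).arith) (hinj : Function.Injective ψ)
    (hopen : IsOpen (Set.range ψ))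
    (haug : ∀ x, ((𝒟.datum b).ext X).aug (ψ x) = ((𝒟.datum b).ext X).aug x) :
    Function.Surjective ψ := by
  -- the model in which every member is its own `k`-core (and `Π_D := Π_C`, all free data)
  let M' : EllipticModel 𝒟 :=
    { M with
      coreExt := fun b X => (𝒟.datum b).ext X
      toCore := fun b X => 𝟙 _
      toCore_isOpenInjective := fun b X => Hom.IsOpenInjective.id _
      toCore_gal_bijective := fun b X => ⟨fun _ _ hxy => hxy, fun x => ⟨x, rfl⟩⟩
      doubleCovers := fun _ _ => Set.univ
      PiD := fun _ => ⊤
      PiD_mem := fun _ => Set.mem_univ _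
      map_PiV_le := fun _ => le_top }
  have h' : M'.IsCor33Member b X :=
    ⟨h.mem, h.ellipticallyAdmissible, h.slim, h.cyclotomic, h.geom_slim, h.geom_ne_bot⟩
  obtain ⟨c, -, ⟨-, e, he, -⟩, hterm, -⟩ := H M' hfull hGC b X h'
  -- the trivial chain `Π` (length 0) is an object of `ÉtLoc(Π)` and is pro-`Σ` by hypothesis
  let c₀ := trivialChain (M.cusps b X) h.arith_slim h.geom_slim h.geom_ne_bot
  have hobj : c₀.IsEtLocObj := fun j => j.elim0
  obtain ⟨-, huniq⟩ := hterm c₀ hobj hS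
  -- two injective open terminal homomorphisms `Π → c.last`: `e⁻¹` and `e⁻¹ ∘ ψ`
  let φ : c₀.last.grp →ₜ* c.last.grp := ⟨e.symm.toMulEquiv.toMonoidHom, e.symm.continuous_toFun⟩
  let φ' : c₀.last.grp →ₜ* c.last.grp := φ.comp ψ
  have hφx : ∀ x, φ x = e.symm x := fun _ => rfl
  have hφ'x : ∀ x, φ' x = e.symm (ψ x) := fun _ => rfl
  have hproj : ∀ x : ((𝒟.datum b).ext X).arith, c.last.proj (e.symm x) = ((𝒟.datum b).ext X).aug x :=
    fun x => by
      have hx := he (e.symm x)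
      rw [e.apply_symm_apply] at hx
      exact hx.symm
  have hφinj : Function.Injective φ := fun x y hxy => e.symm.injective (by rwa [hφx, hφx] at hxy)
  have hφopen : IsOpen (Set.range φ) := by
    have hr : Set.range φ = Set.univ := Set.range_eq_univ.mpr fun y => ⟨e y, by rw [hφx, e.symm_apply_apply]⟩
    rw [hr]
    exact isOpen_univ
  have hφc : ∀ x, c.last.proj (φ x) = MulAut.conj (1 : ((𝒟.datum b).ext X).gal) (c₀.last.proj x) :=
    fun x => by
      rw [map_one, MulAut.one_apply, hφx, hproj]
      rfl
  have hφ'inj : Function.Injective φ' := fun x y hxy => by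
    rw [hφ'x, hφ'x] at hxy
    exact hinj (e.symm.injective hxy)
  have hφ'open : IsOpen (Set.range φ') := by
    have hr : Set.range φ' = e.symm '' Set.range ψ := by
      ext y
      constructor
      · rintro ⟨x, rfl⟩
        exact ⟨ψ x, ⟨x, rfl⟩, (hφ'x x).symm⟩
      · rintro ⟨z, ⟨x, rfl⟩, rfl⟩
        exact ⟨x, hφ'x x⟩
    rw [hr]
    exact e.symm.toHomeomorph.isOpenMap _ hopen
  have hφ'c : ∀ x, c.last.proj (φ' x) = MulAut.conj (1 : ((𝒟.datum b).ext X).gal) (c₀.last.proj x) :=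
    fun x => by
      rw [map_one, MulAut.one_apply, hφ'x, hproj, haug]
      rfl
  obtain ⟨t, ht⟩ := huniq φ φ' 1 1 hφinj hφopen hφc hφ'inj hφ'open hφ'c
  -- hence `ψ = Inn(e t)`, which is onto
  have hψ : ∀ x, ψ x = e t * x * (e t)⁻¹ := fun x => by
    have hx := congrArg e (ht x)
    rw [hφ'x, hφx, e.apply_symm_apply, map_mul, map_mul, map_inv, e.apply_symm_apply] at hx
    exact hx
  intro y
  refine ⟨(e t)⁻¹ * y * e t, ?_⟩
  rw [hψ]
  group

/-- **A kernel inhabitant of the standing hypotheses of Cor 3.3 with a non-surjective open injective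
endomorphism over `G`** (built inside the proof; universe `0`): the one-object class of construction
data over the REAL field `ℚ₂` with `Hom := ` outer isomorphisms over `G_{ℚ₂}` (rel-isom-DGC
tautological, chain-full vacuous), member `Π := Iw₂ × G_{ℚ₂} ↠ G_{ℚ₂}` (`Δ = Iw₂` slim nontrivial,
`G_{ℚ₂}` slim, `χ₂` open, `Σ` = all primes), a junk `EllipticModel` with one setting, and
`ψ((a,s),g) := ((2a,s),g)`. [cite: MochizukiAbsTopII2013, Cor 3.3 pp.67-69] -/
theorem exists_isCor33Member_witness :
    ∃ (𝒟 : ConstructionDataClass.{0}) (M : EllipticModel 𝒟) (b : 𝒟.Base) (X : (𝒟.datum b).Obj)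
      (_ : M.IsCor33Member b X),
      𝒟.IsChainFull ∧ 𝒟.RelIsomDGC ∧ Nonempty (M.Setting b X) ∧ (𝒟.datum b).primes = Set.univ ∧
      ∃ ψ : ((𝒟.datum b).ext X).arith →ₜ* ((𝒟.datum b).ext X).arith,
        Function.Injective ψ ∧ IsOpen (Set.range ψ) ∧
          (∀ x, ((𝒟.datum b).ext X).aug (ψ x) = ((𝒟.datum b).ext X).aug x) ∧
          ¬ Function.Surjective ψ := by
  classical
  -- the groups: `Δ := Iw 2`, `G := G_{ℚ₂}`, `Π := Δ × G`
  let G : ProfiniteGrp.{0} := absoluteGaloisGrp ℚ_[2]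
  let A : AugmentedProfiniteGrp G :=
    ⟨ProfiniteGrp.of (Iw 2 × Field.absoluteGaloisGroup ℚ_[2]),
      ContinuousMonoidHom.snd (Iw 2) (Field.absoluteGaloisGroup ℚ_[2]), fun g => ⟨(1, g), rfl⟩⟩
  -- the tautological one-object datum: morphisms ARE the outer isomorphisms over `G`
  let D : RelativeAnabelianDatum G :=
    { Obj := PUnit.{1}
      Hom := fun _ _ => {c : A.OuterHom A // c.IsIso}
      IsIso := fun _ => True
      IsHyperbolicCurve := fun _ => True
      primes := Set.univ
      grp := fun _ => A
      outerHom := fun f => f.1 }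
  let 𝒟 : ConstructionDataClass.{0} :=
    { Base := PUnit.{1}
      fld := fun _ => ℚ_[2]
      instField := fun _ => inferInstance
      instCharZero := fun _ => inferInstance
      datum := fun _ => D
      Mem := fun _ _ => True
      IsHyperbolicOrbicurve := fun _ _ => True
      isHyperbolicOrbicurve_of_isHyperbolicCurve := fun _ _ _ => trivial
      chainTerms := fun _ _ => ∅ }
  have hfull : 𝒟.IsChainFull := fun _ _ _ t ht => ht.elim
  have hGC : 𝒟.RelIsomDGC := fun _ _ _ _ _ =>
    ⟨fun f _ => f.2, fun f _ g _ hfg => Subtype.ext hfg, fun c hc => ⟨⟨c, hc⟩, trivial, rfl⟩⟩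
  -- the extension of the member and its junk model data
  let E : FundamentalExtension.{0} := (𝒟.datum PUnit.unit).ext PUnit.unit
  let noCusps : ∀ F : FundamentalExtension.{0}, CuspidalData F := fun F =>
    { Cusp := PEmpty.{1}
      Dcusp := fun x => x.elim
      Icusp := fun x => x.elim
      Icusp_eq := fun x => x.elim
      isClosed_Dcusp := fun x => x.elim
      eq_of_conj := fun x => x.elim }
  let M : EllipticModel 𝒟 :=
    { cusps := fun b X => noCusps _
      IsEllipticallyAdmissible := fun _ _ => True
      coreExt := fun b X => (𝒟.datum b).ext X
      toCore := fun b X => 𝟙 _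
      toCore_isOpenInjective := fun b X => Hom.IsOpenInjective.id _
      toCore_gal_bijective := fun b X => ⟨fun _ _ hxy => hxy, fun x => ⟨x, rfl⟩⟩
      doubleCovers := fun _ _ => Set.univ
      Setting := fun _ _ => PUnit.{1}
      PiD := fun _ => ⊤
      PiD_mem := fun _ => Set.mem_univ _
      galOpen := fun _ => ⊤
      normal_galOpen := fun _ => ⟨fun _ _ _ => Subgroup.mem_top _⟩
      isOpen_galOpen := fun _ => isOpen_univ
      level := fun _ => 1
      level_isSigmaInteger := fun _ => ⟨Nat.one_pos, fun _ _ _ => Set.mem_univ _⟩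
      PiV := fun _ => ⊤
      normal_PiV := fun _ => ⟨fun _ _ _ => Subgroup.mem_top _⟩
      isOpen_PiV := fun _ => isOpen_univ
      PiV_le := fun _ _ _ => Subgroup.mem_top _
      map_PiV_le := fun _ => le_top
      cuspUX := fun {b X} _ => ⟨(𝒟.datum b).ext X, 𝟙 _, fun x => ⟨x, rfl⟩, ⟨fun _ _ hxy => hxy, fun x => ⟨x, rfl⟩⟩⟩
      proSet_geom_cuspUX := fun _ => ⟨fun _ _ _ _ _ _ => Set.mem_univ _⟩
      cuspsUX := fun _ => noCusps _ }
  -- the standing hypotheses of Cor 3.3 hold for the member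
  have hk : IsGeneralizedSubpadicFor ℚ_[2] 2 := (IsSubpadicFor.padic 2).isGeneralizedSubpadicFor
  have hslimG : IsSlimGroup G :=
    isSlimGroup_of_iso_absoluteGaloisGrp_of_isGeneralizedSubpadicFor_holds hk (Iso.refl _)
  have hcyc : IsOpen (Set.range (cyclotomicChar ℚ_[2] 2)) := hk.isOpen_range_cyclotomicChar
  let eΔ : Iw 2 ≃ₜ* E.geom :=
    { toFun := fun x => ⟨(x, 1), (FundamentalExtension.mem_geom _).mpr rfl⟩
      invFun := fun y => y.1.1
      left_inv := fun _ => rfl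
      right_inv := fun y => by
        apply Subtype.ext
        apply Prod.ext
        · rfl
        · exact ((FundamentalExtension.mem_geom _).mp y.2).symm
      map_mul' := fun x y => Subtype.ext (Prod.ext rfl (mul_one _).symm)
      continuous_toFun := (continuous_id.prodMk continuous_const).subtype_mk _
      continuous_invFun := continuous_fst.comp continuous_subtype_val }
  have hslimΔ : IsSlimGroup E.geom :=
    isSlimGroup_of_continuousMulEquiv eΔ ⟨SemiGraphs.Iw.centralizer_eq_bot_of_isOpen⟩
  have hne : E.geom ≠ ⊥ := by
    intro hbot
    have hx : (((⟨1, 0⟩ : Iw 2), (1 : Field.absoluteGaloisGroup ℚ_[2])) : E.arith) ∈ E.geom :=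
      (FundamentalExtension.mem_geom _).mpr rfl
    rw [hbot] at hx
    have hx1 := Subgroup.mem_bot.mp hx
    have ha := congrArg (fun z : Iw 2 × Field.absoluteGaloisGroup ℚ_[2] => z.1.a) hx1
    have ha' : (1 : ℤ_[2]) = 0 := ha.trans rfl
    exact one_ne_zero ha'
  have hmem : M.IsCor33Member PUnit.unit PUnit.unit :=
    { mem := trivial
      ellipticallyAdmissible := trivial
      slim := hslimG
      cyclotomic := ⟨2, inferInstance, Set.mem_univ _, hcyc⟩
      geom_slim := hslimΔ
      geom_ne_bot := hne }
  -- the endomorphism `(a, s) ↦ (2a, s)` of `Iw 2` and `ψ := it × id` of `Π`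
  let ψ₀ : Iw 2 →ₜ* Iw 2 :=
    { toFun := fun x => ⟨(2 : ℤ_[2]) * x.a, x.s⟩
      map_one' := by
        ext
        · show (2 : ℤ_[2]) * 0 = 0
          rw [mul_zero]
        · rfl
      map_mul' := fun x y => by
        ext
        · show (2 : ℤ_[2]) * (x.a + SemiGraphs.IwahoriWitness.w 2 x.s * y.a) =
            2 * x.a + SemiGraphs.IwahoriWitness.w 2 x.s * (2 * y.a)
          ring
        · rfl
      continuous_toFun := (SemiGraphs.Iw.continuous_mk_iff (p := 2)).2
        ⟨continuous_const.mul SemiGraphs.Iw.continuous_a, SemiGraphs.Iw.continuous_s⟩ }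
  have hψ₀x : ∀ x : Iw 2, ψ₀ x = ⟨(2 : ℤ_[2]) * x.a, x.s⟩ := fun _ => rfl
  have h2 : ((2 : ℕ) : ℤ_[2]) = 2 := by norm_cast
  have hψ₀inj : Function.Injective ψ₀ := fun x y hxy => by
    rw [hψ₀x, hψ₀x] at hxy
    have ha := congrArg SemiGraphs.Iw.a hxy
    have hs := congrArg SemiGraphs.Iw.s hxy
    ext
    · exact mul_left_cancel₀ (by rw [← h2]; exact SemiGraphs.Iw.p_ne_zero) ha
    · exact hs
  have hψ₀range : Set.range ψ₀ = (fun x : Iw 2 => x.a) ⁻¹' Metric.ball 0 1 := by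
    ext y
    simp only [Set.mem_preimage, Metric.mem_ball, dist_zero_right]
    constructor
    · rintro ⟨x, rfl⟩
      rw [hψ₀x, PadicInt.norm_lt_one_iff_dvd, h2]
      exact dvd_mul_right _ _
    · intro hy
      rw [PadicInt.norm_lt_one_iff_dvd, h2] at hy
      obtain ⟨a', ha'⟩ := hy
      exact ⟨⟨a', y.s⟩, by rw [hψ₀x]; ext <;> simp [ha']⟩
  have hψ₀open : IsOpen (Set.range ψ₀) := by
    rw [hψ₀range]
    exact Metric.isOpen_ball.preimage SemiGraphs.Iw.continuous_a
  have hψ₀ns : ¬ Function.Surjective ψ₀ := fun hs => by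
    obtain ⟨x, hx⟩ := hs ⟨1, 0⟩
    rw [hψ₀x] at hx
    have ha : (2 : ℤ_[2]) * x.a = 1 := congrArg SemiGraphs.Iw.a hx
    have hlt : ‖(1 : ℤ_[2])‖ < 1 := by
      rw [← ha, PadicInt.norm_lt_one_iff_dvd, h2]
      exact dvd_mul_right _ _
    rw [norm_one] at hlt
    exact lt_irrefl _ hlt
  let ψ : E.arith →ₜ* E.arith :=
    ContinuousMonoidHom.prodMap ψ₀ (ContinuousMonoidHom.id (Field.absoluteGaloisGroup ℚ_[2]))
  have hψx : ∀ z : Iw 2 × Field.absoluteGaloisGroup ℚ_[2], ψ z = (ψ₀ z.1, z.2) := fun _ => rfl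
  refine ⟨𝒟, M, PUnit.unit, PUnit.unit, hmem, hfull, hGC, ⟨PUnit.unit⟩, rfl, ψ, ?_, ?_, ?_, ?_⟩
  · rintro ⟨x₁, g₁⟩ ⟨x₂, g₂⟩ hxy
    rw [hψx, hψx] at hxy
    obtain ⟨h₁, h₂⟩ := Prod.mk.inj hxy
    exact Prod.ext (hψ₀inj h₁) h₂
  · have hr : Set.range ψ = Set.range ψ₀ ×ˢ (Set.univ : Set (Field.absoluteGaloisGroup ℚ_[2])) := by
      ext ⟨y, g⟩
      constructor
      · rintro ⟨⟨x, g'⟩, hx⟩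
        rw [hψx] at hx
        exact ⟨⟨x, (Prod.mk.inj hx).1⟩, Set.mem_univ _⟩
      · rintro ⟨⟨x, hx⟩, -⟩
        refine ⟨(x, g), ?_⟩
        show (ψ₀ x, g) = (y, g)
        rw [hx]
    rw [hr]
    exact hψ₀open.prod isOpen_univ
  · intro z
    rfl
  · intro hs
    apply hψ₀ns
    intro y
    obtain ⟨⟨x, g⟩, hx⟩ := hs (y, 1)
    rw [hψx] at hx
    exact ⟨x, (Prod.mk.inj hx).1⟩

/-- **FACT-LIST F-0289: the universal closure of the schema `EllipticModel.Cor_3_3_i` over `(𝒟, M)` is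
false** — at the `ℚ₂` witness the endomorphism `ψ` is injective, open, over `G`, not onto, against
`forall_cor_3_3_i_imp_coHopfian`.  The row is a schema consumed by name at the intended model.
[cite: MochizukiAbsTopII2013, Cor 3.3 (i) pp.67-68] -/
theorem not_forall_cor_3_3_i :
    ¬ ∀ (𝒟 : ConstructionDataClass.{0}) (M : EllipticModel 𝒟), M.Cor_3_3_i := by
  intro H
  obtain ⟨𝒟, M, b, X, h, hfull, hGC, -, hprimes, ψ, hinj, hopen, haug, hns⟩ :=
    exists_isCor33Member_witness
  refine hns (forall_cor_3_3_i_imp_coHopfian (H 𝒟) hfull hGC M b X h ?_ ψ hinj hopen haug)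
  rw [hprimes]
  exact isProSigmaChain_univ _

/-- **FACT-LIST F-0290: the universal closure of the schema `EllipticModel.Cor_3_3_ii` over `(𝒟, M)`
is false** — the `ℚ₂` witness inhabits `IsCor33Member`, against `forall_cor_3_3_ii_iff_vacuous`.
[cite: MochizukiAbsTopII2013, Cor 3.3 (ii) p.68] -/
theorem not_forall_cor_3_3_ii :
    ¬ ∀ (𝒟 : ConstructionDataClass.{0}) (M : EllipticModel 𝒟), M.Cor_3_3_ii := by
  intro H
  obtain ⟨𝒟, M, b, X, h, hfull, hGC, -⟩ := exists_isCor33Member_witness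
  exact (forall_cor_3_3_ii_iff_vacuous.mp (H 𝒟)) hfull hGC M b X h

/-- **FACT-LIST F-0291: the universal closure of the schema `EllipticModel.Cor_3_3_iii` over `(𝒟, M)`
is false** — the `ℚ₂` witness inhabits `IsCor33Member` WITH a setting, against
`forall_cor_3_3_iii_iff_vacuous`. [cite: MochizukiAbsTopII2013, Cor 3.3 (iii) pp.68-69] -/
theorem not_forall_cor_3_3_iii :
    ¬ ∀ (𝒟 : ConstructionDataClass.{0}) (M : EllipticModel 𝒟), M.Cor_3_3_iii := by
  intro H
  obtain ⟨𝒟, M, b, X, h, hfull, hGC, ⟨s⟩, -⟩ := exists_isCor33Member_witness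
  exact ((forall_cor_3_3_iii_iff_vacuous.mp (H 𝒟)) hfull hGC M b X h).false s

end EllipticModel

end Literature.AnabelianGeometry.AbsoluteAnabelian.AbsTopII
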